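import Literature.NumberTheory.EllipticCurves.BSDSelmerPConverseRankZeroProofs
import Literature.NumberTheory.EllipticCurves.CMTorsionIrreducibleOrdinaryProofs
import HarnessLib

/-!
# Burungale–Tian's rank-zero `p`-converse for CM curves: the good-ordinary slice with the image
# hypothesis discharged

Sibling *proofs* file (theorems only: no definition, no named fact, no instance; D-0014/D-0026)
of `Literature.NumberTheory.EllipticCurves.BSDSelmerCMPConverse`, for its named fact
`Literature.NumberTheory.EllipticCurves.burungaleTian_analyticRank_eq_zero_of_selmerCorank_eq_zero_of_hasCM`
(A. A. Burungale, Y. Tian, Ann. of Math. (2) 203 (2026), 1–13 = arXiv:2506.03465, Thm. 1.1: for a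
CM elliptic curve `E/ℚ` and ANY prime `p`, `corank_{ℤ_p} Sel_{p^∞}(E/ℚ) = 0 ⟹ ord_{s=1} L(s, E/ℚ)
= 0`).

`BSDSelmerPConverseRankZeroProofs` proves the conclusion of that fact, for EVERY `E/ℚ`, at a
good ordinary prime `p ≥ 5` with `E[p]` irreducible, below three existing named facts of the tree
(modularity `exists_isNewformOf`; Mazur's main conjecture
`burungale_castella_skinner_charIdeal_eq_padicLFunction`, which for CM curves is Rubin's theorem
— Greenberg, LNM 1716, p. 66; Perrin-Riou–Schneider `Schneider1985_order_charGenerator`), along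
Greenberg, LNM 1716, §1 pp. 65–66.  For a CM curve the irreducibility of `E[p]` at a good
ordinary `p > 3` is a THEOREM of the tree
(`WeierstrassCurve.hasIrreducibleModPGaloisRep_of_hasCM_of_five_le`,
`CMTorsionIrreducibleOrdinaryProofs`: Serre 1972 §4.5/§1.11 — the image over `ℚ` normalises the
Cartan subgroup and `p`, being ordinary, does not divide the CM discriminant), so on CM curves the
slice holds with no image hypothesis at all:

* `entireLFunction_one_ne_zero_of_finite_selmerGroupPInfty_of_hasCM_of_mainConjecture` —
  `Sel_{p^∞}(E/ℚ)` finite ⟹ `L(E, 1) ≠ 0`;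
* `analyticRank_eq_zero_of_selmerCorank_eq_zero_of_hasCM_of_mainConjecture` — the fact's
  conclusion `corank 0 ⟹ ord_{s=1} L(E, s) = 0` for every CM `E/ℚ` (global minimal model) and
  every good ordinary `p ≥ 5`;
* `one_le_selmerCorank_of_entireLFunction_one_eq_zero_of_hasCM_of_mainConjecture` — the
  contrapositive (`L(E,1) = 0 ⟹ Sel_{p^∞}(E/ℚ)` infinite; Rubin, LNM 1716, Cor. 12.13 (i) shape);
* `burungaleTian_cmField_of_hasCM_of_mainConjecture` — Theorem 1.1 proper over the CM field `K`
  for curves descending to `ℚ` with CM by `𝓞_K`, on the same slice.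

This is exactly the part of Burungale–Tian's theorem that was known before it (arXiv p. 1, (1.2):
Rubin's `p`-converse for `p ∤ #𝓞_K^×`, here at the ordinary = split primes `p ≥ 5`), now sitting
below three named facts instead of one; the supersingular (inert or ramified) primes, `p = 2, 3`
and the bad primes — Burungale–Tian's new content, via Kato's main conjecture for CM newforms —
remain out of reach of the tree (see the module docstring of `BSDSelmerPConverseRankZeroProofs`).

## References

* [BurungaleTian2026] A. A. Burungale, Y. Tian, Ann. of Math. (2) 203 (2026), 1–13 =
  arXiv:2506.03465v2: p. 1 (1.1), (1.2), Thm. 1.1; §3.1 (p. 6, the descent `K → ℚ`).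
* [GreenbergLNM1716] R. Greenberg, *Iwasawa theory for elliptic curves*, LNM 1716 (1999), §1
  pp. 65–66 (held: `book:coates1999-arithmetic-theory-elliptic-curves`).
* [BurungaleCastellaSkinner2025] A. Burungale, F. Castella, C. Skinner, IMRN 2025 =
  arXiv:2405.00270, Thm. 1.1.2 (a) and proof of Cor. 1.3.1.
* [Serre1972] J.-P. Serre, Invent. Math. 15 (1972), §1.11, §4.5.
-/

namespace Literature.NumberTheory.EllipticCurves

open _root_.WeierstrassCurve Literature.NumberTheory.EllipticCurves.ModularForms

/-- **Rank-zero `p`-converse for CM curves at a good ordinary prime `p ≥ 5`, `L`-value form, with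
no image hypothesis.**  Let `E/ℚ` have complex multiplication, `W` a global minimal model, `p ≥ 5`
a prime of good ordinary reduction.  Granted modularity (`hmod`), Mazur's main conjecture in
`Λ ⊗ ℚ_p` (`hMC`, Burungale–Castella–Skinner 2025 Thm. 1.1.2 (a); for CM curves Rubin's theorem,
Greenberg LNM 1716 p. 66) and Perrin-Riou–Schneider (`hS`): if `Sel_{p^∞}(E/ℚ)` is finite then
`L(E, 1) ≠ 0`.  The hypothesis `(irr_ℚ)` of the general slice
`entireLFunction_one_ne_zero_of_finite_selmerGroupPInfty_of_mainConjecture` is discharged by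
`WeierstrassCurve.hasIrreducibleModPGaloisRep_of_hasCM_of_five_le` (Serre 1972 §4.5/§1.11).  This
is Rubin's rank-zero `p`-converse (Burungale–Tian (1.2): `p ∤ #𝓞_K^×`) at the ordinary primes
`p ≥ 5`, below the three named facts. [cite: BurungaleTian2026, (1.1)–(1.2) p. 1]
[cite: GreenbergLNM1716, §1 pp. 65–66] [cite: BurungaleCastellaSkinner2025, Thm. 1.1.2 (a)] -/
theorem entireLFunction_one_ne_zero_of_finite_selmerGroupPInfty_of_hasCM_of_mainConjecture
    (hmod : exists_isNewformOf)
    (hMC : burungale_castella_skinner_charIdeal_eq_padicLFunction)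
    (hS : Schneider1985_order_charGenerator)
    (W : WeierstrassCurve ℚ) [W.IsElliptic] [W.IsGloballyMinimal] (hCM : W.HasCM) (p : ℕ)
    [Fact p.Prime] (hp : 5 ≤ p) (hgood : W.HasGoodReductionAtPrime p)
    (hord : ¬ (p : ℤ) ∣ W.frobeniusTrace p) (hSel : Finite (W.selmerGroupPInfty p)) :
    W.entireLFunction 1 ≠ 0 :=
  entireLFunction_one_ne_zero_of_finite_selmerGroupPInfty_of_mainConjecture hmod hMC hS W p hp
    hgood hord (W.hasIrreducibleModPGaloisRep_of_hasCM_of_five_le hCM p hp hgood hord) hSel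

/-- **Burungale–Tian's Theorem 1.1 over `ℚ` (rank zero) on its good-ordinary slice, for every CM
curve and every good ordinary `p ≥ 5`, below modularity, Mazur's main conjecture and
Perrin-Riou–Schneider — with no image hypothesis**: `corank_{ℤ_p} Sel_{p^∞}(E/ℚ) = 0 ⟹
ord_{s=1} L(E, s) = 0`.  This is the conclusion of the named fact
`burungaleTian_analyticRank_eq_zero_of_selmerCorank_eq_zero_of_hasCM` on that slice (the fact
itself covers every prime: the supersingular = inert-or-ramified primes and `p = 2, 3` are
Burungale–Tian's new content and are not reached here). [cite: BurungaleTian2026, Thm. 1.1 and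
(1.2) p. 1] [cite: GreenbergLNM1716, §1 pp. 65–66] -/
theorem analyticRank_eq_zero_of_selmerCorank_eq_zero_of_hasCM_of_mainConjecture
    (hmod : exists_isNewformOf)
    (hMC : burungale_castella_skinner_charIdeal_eq_padicLFunction)
    (hS : Schneider1985_order_charGenerator)
    (W : WeierstrassCurve ℚ) [W.IsElliptic] [W.IsGloballyMinimal] (hCM : W.HasCM) (p : ℕ)
    [Fact p.Prime] (hp : 5 ≤ p) (hgood : W.HasGoodReductionAtPrime p)
    (hord : ¬ (p : ℤ) ∣ W.frobeniusTrace p) (h0 : W.selmerCorank p = 0) :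
    W.analyticRank = 0 :=
  analyticRank_eq_zero_of_selmerCorank_eq_zero_of_mainConjecture hmod hMC hS W p hp hgood hord
    (W.hasIrreducibleModPGaloisRep_of_hasCM_of_five_le hCM p hp hgood hord) h0

/-- **Contrapositive for CM curves: `L(E, 1) = 0 ⟹ corank_{ℤ_p} Sel_{p^∞}(E/ℚ) ≥ 1`** at every
good ordinary `p ≥ 5` (so `Sel_{p^∞}(E/ℚ)` is infinite), below the same three facts and with no
image hypothesis — the shape of Rubin, LNM 1716, Cor. 12.13 (i) ("if `L(ψ̄, 1) = 0` then
`S_{p^∞}` is infinite") at split `p`. [cite: GreenbergLNM1716, §1 pp. 65–66]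
[cite: BurungaleTian2026, (1.2) p. 1] -/
theorem one_le_selmerCorank_of_entireLFunction_one_eq_zero_of_hasCM_of_mainConjecture
    (hmod : exists_isNewformOf)
    (hMC : burungale_castella_skinner_charIdeal_eq_padicLFunction)
    (hS : Schneider1985_order_charGenerator)
    (W : WeierstrassCurve ℚ) [W.IsElliptic] [W.IsGloballyMinimal] (hCM : W.HasCM) (p : ℕ)
    [Fact p.Prime] (hp : 5 ≤ p) (hgood : W.HasGoodReductionAtPrime p)
    (hord : ¬ (p : ℤ) ∣ W.frobeniusTrace p) (hL : W.entireLFunction 1 = 0) :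
    1 ≤ W.selmerCorank p :=
  one_le_selmerCorank_of_entireLFunction_one_eq_zero_of_mainConjecture hmod hMC hS W p hp hgood
    hord (W.hasIrreducibleModPGaloisRep_of_hasCM_of_five_le hCM p hp hgood hord) hL

/-- **Theorem 1.1 of Burungale–Tian over the CM field `K`, for curves descending to `ℚ` with CM by
the maximal order, at a good ordinary `p ≥ 5`, below the same three facts and with no image
hypothesis**: `corank_{ℤ_p} Sel_{p^∞}(E/K) = 0 ⟹ ord_{s=1} L(s, E/K) = 0`
(`burungaleTian_cmField_of_mainConjecture` with `(irr_ℚ)` discharged; `j(E) ∈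
maximalCMJInvariants` gives `HasCM` by `hasCM_of_j_mem_maximalCMJInvariants_holds`).
[cite: BurungaleTian2026, Thm. 1.1 and §3.1 (arXiv p. 6)] [cite: GreenbergLNM1716, §1 p. 66] -/
theorem burungaleTian_cmField_of_hasCM_of_mainConjecture
    (hmod : exists_isNewformOf)
    (hMC : burungale_castella_skinner_charIdeal_eq_padicLFunction)
    (hS : Schneider1985_order_charGenerator)
    (W : WeierstrassCurve ℚ) [W.IsElliptic] [W.IsGloballyMinimal]
    (hj : W.j ∈ maximalCMJInvariants) (K : Type) [Field K] [NumberField K]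
    (hK : IsCMFieldOfJ K W.j) (p : ℕ) [Fact p.Prime] (hp : 5 ≤ p)
    (hgood : W.HasGoodReductionAtPrime p) (hord : ¬ (p : ℤ) ∣ W.frobeniusTrace p)
    (h0 : (W.baseChange K).selmerCorank p = 0) :
    (W.baseChange K).analyticRank = 0 :=
  burungaleTian_cmField_of_mainConjecture hmod hMC hS W hj K hK p hp hgood hord
    (W.hasIrreducibleModPGaloisRep_of_hasCM_of_five_le
      (hasCM_of_j_mem_maximalCMJInvariants_holds W hj) p hp hgood hord) h0

end Literature.NumberTheory.EllipticCurves
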